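import Summits.Ventures.PercRepro.S1DisjointSumRank

/-!
# PercRepro — A SEPARATOR SPLITS A MATROID INTO THE DISJOINT SUM OF ITS TWO RESTRICTIONS (p2, gen 28;
SUBCLAIM-S1 §6.10 (xvii)(g)–(h): the bridge from «1-separable» to `Matroid.disjointSum`)

If `ρ(A) + ρ(E ∖ A) = ρ(E)` (a *separator* `A ⊆ E`), then the rank splits across `A` on every set,
`ρ(X) = ρ(X ∩ A) + ρ(X ∖ A)` (two applications of submodularity), hence a set is independent iff its two traces
are, hence `M = (M ↾ A) ⊕ (M ↾ (E ∖ A))` as matroids. This is what lets the circuit-summand consumers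
(`S1DisjointSumCircuit*`, stated for a literal `M.disjointSum N h`) speak about a matroid that merely *has* a
circuit separator. Nothing is claimed about any cell.

* `eRk_eq_eRk_inter_add_eRk_sdiff_of_separator` — the rank splits across a separator;
* `indep_iff_of_separator` — independence is trace-wise across a separator;
* **`eq_disjointSum_restrict_of_separator`** — `M = (M ↾ A).disjointSum (M ↾ (M.E \ A)) _`;
* `restrict_coloops_eq_empty_of_separator` — a coloop of `M ↾ A` is a coloop of `M` when `A` is a separator, so
  coloop-freeness passes to the part.
Axioms: standard.
-/

open scoped Matroid

namespace PercRepro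

namespace S1

open Set

variable {α : Type}

/-- **The rank splits across a separator**: if `ρ(A) + ρ(E ∖ A) = ρ(E)` then `ρ(X) = ρ(X ∩ A) + ρ(X ∖ A)` for
every `X ⊆ E`. -/
theorem eRk_eq_eRk_inter_add_eRk_sdiff_of_separator (M : Matroid α) [M.Finite] {A : Set α} (hA : A ⊆ M.E)
    (hsep : M.eRk A + M.eRk (M.E \ A) = M.eRank) {X : Set α} (hX : X ⊆ M.E) :
    M.eRk X = M.eRk (X ∩ A) + M.eRk (X \ A) := by
  have hfin : ∀ Y : Set α, Y ⊆ M.E → M.eRk Y ≠ ⊤ := fun Y hY =>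
    ((M.eRk_le_encard Y).trans_lt (M.ground_finite.subset hY).encard_lt_top).ne
  obtain ⟨x, hx⟩ := ENat.ne_top_iff_exists.mp (hfin X hX)
  obtain ⟨a, ha⟩ := ENat.ne_top_iff_exists.mp (hfin (X ∩ A) (inter_subset_left.trans hX))
  obtain ⟨b, hb⟩ := ENat.ne_top_iff_exists.mp (hfin (X \ A) (sdiff_subset.trans hX))
  obtain ⟨pA, hpA⟩ := ENat.ne_top_iff_exists.mp (hfin A hA)
  obtain ⟨pB, hpB⟩ := ENat.ne_top_iff_exists.mp (hfin (M.E \ A) sdiff_subset)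
  obtain ⟨pE, hpE⟩ := ENat.ne_top_iff_exists.mp (hfin M.E subset_rfl)
  obtain ⟨u, hu⟩ := ENat.ne_top_iff_exists.mp (hfin (X ∪ (M.E \ A)) (union_subset hX sdiff_subset))
  -- submodularity on `X` and `E ∖ A`
  have S1 := M.eRk_inter_add_eRk_union_le X (M.E \ A)
  have e1 : X ∩ (M.E \ A) = X \ A := by
    ext y; simp only [mem_inter_iff, mem_sdiff]; constructor
    · rintro ⟨hyX, -, hyA⟩; exact ⟨hyX, hyA⟩
    · rintro ⟨hyX, hyA⟩; exact ⟨hyX, hX hyX, hyA⟩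
  rw [e1] at S1
  -- submodularity on `A` and `X ∪ (E ∖ A)`
  have S2 := M.eRk_inter_add_eRk_union_le A (X ∪ (M.E \ A))
  have e2 : A ∩ (X ∪ (M.E \ A)) = X ∩ A := by
    ext y; simp only [mem_inter_iff, mem_union, mem_sdiff]; constructor
    · rintro ⟨hyA, hyX | ⟨-, hyA'⟩⟩
      · exact ⟨hyX, hyA⟩
      · exact absurd hyA hyA'
    · rintro ⟨hyX, hyA⟩; exact ⟨hyA, Or.inl hyX⟩
  have e3 : A ∪ (X ∪ (M.E \ A)) = M.E := by
    apply subset_antisymm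
    · exact union_subset hA (union_subset hX sdiff_subset)
    · intro y hy
      by_cases hyA : y ∈ A
      · exact Or.inl hyA
      · exact Or.inr (Or.inr ⟨hy, hyA⟩)
  rw [e2, e3, ← M.eRank_def] at S2
  -- the union bound
  have S3 := M.eRk_union_le_eRk_add_eRk (X ∩ A) (X \ A)
  rw [inter_union_sdiff] at S3
  have S1' : b + u ≤ x + pB := by
    rw [← hb, ← hu, ← hx, ← hpB] at S1
    exact_mod_cast S1
  have S2' : a + pE ≤ pA + u := by
    rw [M.eRank_def, ← ha, ← hpE, ← hpA, ← hu] at S2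
    exact_mod_cast S2
  have S3' : x ≤ a + b := by
    rw [← hx, ← ha, ← hb] at S3
    exact_mod_cast S3
  have hsep' : pA + pB = pE := by
    rw [M.eRank_def, ← hpA, ← hpB, ← hpE] at hsep
    exact_mod_cast hsep
  have hxab : x = a + b := by omega
  rw [← hx, ← ha, ← hb, hxab]
  push_cast
  rfl

/-- **Independence is trace-wise across a separator**: for `I ⊆ E`, `I` is independent iff `I ∩ A` and `I ∖ A`
are. -/
theorem indep_iff_of_separator (M : Matroid α) [M.Finite] {A : Set α} (hA : A ⊆ M.E)
    (hsep : M.eRk A + M.eRk (M.E \ A) = M.eRank) {I : Set α} (hI : I ⊆ M.E) :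
    M.Indep I ↔ M.Indep (I ∩ A) ∧ M.Indep (I \ A) := by
  constructor
  · intro h
    exact ⟨h.subset inter_subset_left, h.subset sdiff_subset⟩
  · rintro ⟨h1, h2⟩
    have hIfin : I.Finite := M.ground_finite.subset hI
    rw [Matroid.indep_iff_eRk_eq_encard_of_finite hIfin,
      eRk_eq_eRk_inter_add_eRk_sdiff_of_separator M hA hsep hI, h1.eRk_eq_encard, h2.eRk_eq_encard,
      ← (hIfin.inter_of_left A).cast_ncard_eq, ← hIfin.sdiff.cast_ncard_eq, ← hIfin.cast_ncard_eq,
      ← Nat.cast_add, ncard_inter_add_ncard_sdiff_eq_ncard I A hIfin]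

/-- **A separator splits the matroid**: if `ρ(A) + ρ(E ∖ A) = ρ(E)` then
`M = (M ↾ A).disjointSum (M ↾ (E ∖ A))`. -/
theorem eq_disjointSum_restrict_of_separator (M : Matroid α) [M.Finite] {A : Set α} (hA : A ⊆ M.E)
    (hsep : M.eRk A + M.eRk (M.E \ A) = M.eRank) :
    M = (M ↾ A).disjointSum (M ↾ (M.E \ A)) (by simp only [Matroid.restrict_ground_eq]; exact disjoint_sdiff_right) := by
  apply Matroid.ext_indep
  · simp only [Matroid.disjointSum_ground_eq, Matroid.restrict_ground_eq]
    rw [union_sdiff_cancel hA]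
  · intro I hI
    rw [Matroid.disjointSum_indep_iff]
    simp only [Matroid.restrict_indep_iff, Matroid.restrict_ground_eq]
    rw [indep_iff_of_separator M hA hsep hI]
    have e1 : I ∩ (M.E \ A) = I \ A := by
      ext y; simp only [mem_inter_iff, mem_sdiff]; constructor
      · rintro ⟨hyI, -, hyA⟩; exact ⟨hyI, hyA⟩
      · rintro ⟨hyI, hyA⟩; exact ⟨hyI, hI hyI, hyA⟩
    rw [e1]
    constructor
    · rintro ⟨h1, h2⟩
      exact ⟨⟨h1, inter_subset_right⟩, ⟨h2, fun y hy => ⟨hI hy.1, hy.2⟩⟩,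
        by rw [union_sdiff_cancel hA]; exact hI⟩
    · rintro ⟨⟨h1, -⟩, ⟨h2, -⟩, -⟩
      exact ⟨h1, h2⟩

/-- **Coloop-freeness passes to the part**: across a separator `A`, a coloop of `M ↾ A` is a coloop of `M`
(`ρ(E ∖ e) = ρ(A ∖ e) + ρ(E ∖ A) = ρ(E) − 1`), so `M` coloop-free makes `M ↾ A` coloop-free. -/
theorem restrict_coloops_eq_empty_of_separator (M : Matroid α) [M.Finite] {A : Set α} (hA : A ⊆ M.E)
    (hsep : M.eRk A + M.eRk (M.E \ A) = M.eRank) (hcol : M.coloops = ∅) : (M ↾ A).coloops = ∅ := by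
  rw [eq_empty_iff_forall_notMem]
  intro e he
  have he' : (M ↾ A).IsColoop e := he
  rw [Matroid.restrict_isColoop_iff hA] at he'
  obtain ⟨hecl, heA⟩ := he'
  have heE : e ∈ M.E := hA heA
  -- `e` is a coloop of `M`
  have hcolM : M.IsColoop e := by
    rw [Matroid.isColoop_iff_notMem_closure_compl heE]
    intro hmem
    -- ranks
    have hfin : ∀ Y : Set α, Y ⊆ M.E → M.eRk Y ≠ ⊤ := fun Y hY =>
      ((M.eRk_le_encard Y).trans_lt (M.ground_finite.subset hY).encard_lt_top).ne
    have h1 : M.eRk (M.E \ {e}) = M.eRank := by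
      have h := (mem_closure_iff_eRk_insert_eq M heE sdiff_subset).mp hmem
      rw [insert_sdiff_self_of_mem heE, M.eRk_ground] at h
      exact h.symm
    have h2 : M.eRk A = M.eRk (A \ {e}) + 1 := by
      have h := Matroid.eRk_insert_eq_add_one (M := M) (e := e) (X := A \ {e}) ⟨heE, hecl⟩
      rw [insert_sdiff_self_of_mem heA] at h
      exact h
    have h3 := eRk_eq_eRk_inter_add_eRk_sdiff_of_separator M hA hsep (X := M.E \ {e}) sdiff_subset
    have e1 : (M.E \ {e}) ∩ A = A \ {e} := by
      ext y; simp only [mem_inter_iff, mem_sdiff, mem_singleton_iff]; constructor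
      · rintro ⟨⟨-, hye⟩, hyA⟩; exact ⟨hyA, hye⟩
      · rintro ⟨hyA, hye⟩; exact ⟨⟨hA hyA, hye⟩, hyA⟩
    have e2 : (M.E \ {e}) \ A = M.E \ A := by
      ext y; simp only [mem_sdiff, mem_singleton_iff]; constructor
      · rintro ⟨⟨hyE, -⟩, hyA⟩; exact ⟨hyE, hyA⟩
      · rintro ⟨hyE, hyA⟩; exact ⟨⟨hyE, fun hye => hyA (hye ▸ heA)⟩, hyA⟩
    rw [e1, e2, h1] at h3
    rw [h2] at hsep
    -- hsep : ρ(A ∖ e) + 1 + ρ(E ∖ A) = ρ(E); h3 : ρ(E) = ρ(A ∖ e) + ρ(E ∖ A)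
    obtain ⟨a, ha⟩ := ENat.ne_top_iff_exists.mp (hfin (A \ {e}) (sdiff_subset.trans hA))
    obtain ⟨b, hb⟩ := ENat.ne_top_iff_exists.mp (hfin (M.E \ A) sdiff_subset)
    obtain ⟨n, hn⟩ := ENat.ne_top_iff_exists.mp (hfin M.E subset_rfl)
    rw [M.eRank_def, ← ha, ← hb, ← hn] at hsep h3
    have hsep' : a + 1 + b = n := by exact_mod_cast hsep
    have h3' : n = a + b := by exact_mod_cast h3
    omega
  have : e ∈ M.coloops := hcolM
  rw [hcol] at this
  exact this

end S1

end PercRepro
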